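import Summits.KontsevichZagierPeriods.KontsevichZagierPeriods.Theorems.UnfoldedStokesStokesGenerationFibrewiseRungDimOneMixed
import Summits.KontsevichZagierPeriods.KontsevichZagierPeriods.Theorems.UnfoldedStokesStokesGenerationStubRawPartialFractions
import Summits.KontsevichZagierPeriods.KontsevichZagierPeriods.Theorems.UnfoldedStokesStokesGenerationStubQuadPoleReduction
import Summits.KontsevichZagierPeriods.KontsevichZagierPeriods.Theorems.HurwitzMicroSectorsNormalFormPrincipleAlgSplitK5Kit
import Summits.KontsevichZagierPeriods.KontsevichZagierPeriods.Theorems.HurwitzMicroSectorsNormalFormPrincipleSplitAlgebra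

/-!
# `StokesGeneration` (stmt-KontsevichZagierPeriods-3586), line `fibrewise_stokes` — rung 8, III: the rational layer over the real algebraic numbers

Crux `Summit.KontsevichZagierPeriods.KontsevichZagierPeriods.Theses.UnfoldedStokes.StokesGeneration`; residual S2 =
`FibrewiseStokesGenerationConjecture`. Rung 8, part III (lead c5): **S2 holds for EVERY rational integrand of
dimension one over the real algebraic numbers** — a closed-interval representation with integrand `P/Q`,
`P, Q ∈ K[X]` (`K = algebraicClosure ℚ ℝ`), `Q` zero-free on `[0,1]`, and value `0` is fibrewise-Stokes decomposable
(`fibStokesDecomposable_ratAlgK`); kernel form `of_mem_relations_ratAlgK` (the S2-economy twin of the landed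
`stub_kernelAlgKInterval`, p128269, which used all four moves through route HurwitzMicroSectors' normal forms).
Proof: pointwise real partial fractions over `K` (`stub_rawPartialFractions`, p130730; peel lemmas of route
HurwitzMicroSectors) present `P/Q` on `[0,1]` as a MIXED form for part II: the polynomial part and the higher-order
real poles are exact (`exists_polynomial_hasDerivAtK`, `hasDerivAt_const_div_pow`), a simple real pole `c/(t − ρ)`
(`ρ ∉ [0,1]` since `Q(ρ) = 0`) is the dlog of the POSITIVE linear polynomial `±(t − ρ)`, and
`(a t + b)/((t − u)² + v²)^{n+1}` is exact + `e₁`·dlog of the positive quadratic + `e₂·v/q`, i.e. `−e₂` times the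
angular derivative of the linear loop `t − u + iv` (`stub_quadPoleReduction`, p130967, the classical reduction of
`∫ dt/(t² + v²)ⁿ` in certificate form).

References: M. Kontsevich, D. Zagier, *Periods* (2001), §1.1–1.2; J. Ayoub, Ann. of Math. 181 (2015), Conj. 1.1,
Rem. 1.5; J. Fresán, *Une introduction aux périodes* (2024), Conj. 3.5, Rem. 3.7; A. Baker, *Transcendental Number
Theory* (1975), Ch. 2, Thm. 2.1.
-/

noncomputable section

set_option linter.dupNamespace false

namespace Summit.KontsevichZagierPeriods.KontsevichZagierPeriods.Cruxes.StokesGeneration.FibrewiseStokes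

open MeasureTheory Set
open Literature.NumberTheory.Transcendental
open Literature.NumberTheory.Transcendental.KZ
open Literature.ModelTheory.ExponentialFields (IsSemialgebraic)

open scoped Polynomial
open Summit.KontsevichZagierPeriods.HurwitzMicroSectors.NormalFormPrinciple.PiBox.AlgSplitK5
  (isAlgebraic_coeK aevalK_coe isSemialgebraicFunOn_aevalK isSemialgebraicFunOn_aevalK_div exists_polynomial_hasDerivAtK)
open Summit.KontsevichZagierPeriods.HurwitzMicroSectors.NormalFormPrinciple.PiBox.Dlog (hasDerivAt_const_div_pow)

/-! ## Rung 8, part III: the rational layer over the real algebraic numbers -/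



/-- Coefficients of a `K`-polynomial (`K = algebraicClosure ℚ ℝ`) mapped to `ℝ[X]` are algebraic. [folklore] -/
theorem isAlgebraic_coeff_mapK (p : Polynomial (algebraicClosure ℚ ℝ)) (n : ℕ) :
    IsAlgebraic ℚ ((p.map (algebraMap (algebraicClosure ℚ ℝ) ℝ)).coeff n) := by
  rw [Polynomial.coeff_map]; exact isAlgebraic_coeK _

/-- Evaluation of a mapped `K`-polynomial is `aeval`. [folklore] -/
theorem eval_mapK (p : Polynomial (algebraicClosure ℚ ℝ)) (t : ℝ) :
    (p.map (algebraMap (algebraicClosure ℚ ℝ) ℝ)).eval t = Polynomial.aeval t p := by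
  rw [Polynomial.eval_map, ← Polynomial.aeval_def]

/-- Evaluation of the derivative of a mapped `K`-polynomial is `aeval` of the derivative. [folklore] -/
theorem eval_derivative_mapK (p : Polynomial (algebraicClosure ℚ ℝ)) (t : ℝ) :
    (Polynomial.derivative (p.map (algebraMap (algebraicClosure ℚ ℝ) ℝ))).eval t =
      Polynomial.aeval t (Polynomial.derivative p) := by
  rw [Polynomial.derivative_map, eval_mapK]

/-- **Every `K`-rational integrand is a mixed form on `[0,1]`** (`K = algebraicClosure ℚ ℝ`): for `P, Q ∈ K[X]` with `Q`
zero-free on `[0,1]` there are positive polynomials `pⱼ` with algebraic coefficients and algebraic `cⱼ` (dlog part),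
zero-free polynomial loops `(Aₖ, Bₖ)` with algebraic coefficients and algebraic `dₖ` (angular part), and a
`ℚ`-semialgebraic primitive `G₀` with `ℚ`-semialgebraic continuous derivative `g₀` on `[0,1]` (exact part) such that
`P/Q = g₀ + Σⱼ cⱼ pⱼ′/pⱼ + Σₖ dₖ (Aₖ Bₖ′ − Aₖ′ Bₖ)/(Aₖ² + Bₖ²)` on `[0,1]` — pointwise real partial fractions over `K`
(`stub_rawPartialFractions`): the polynomial part and the higher-order real poles are exact
(`exists_polynomial_hasDerivAtK`, `hasDerivAt_const_div_pow`), a simple real pole `c/(t − ρ)` (`ρ ∉ [0,1]`) is the dlog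
of the positive linear polynomial `±(t − ρ)`, and `(a t + b)/((t − u)² + v²)^{n+1}` is exact + dlog of the positive
quadratic + a multiple of the angular derivative of the linear loop `t − u + iv` (`stub_quadPoleReduction`).
[folklore] -/
theorem exists_mixedForm_ratAlgK (P Q : Polynomial (algebraicClosure ℚ ℝ))
    (hQ : ∀ u ∈ Set.Icc (0:ℝ) 1, (Polynomial.aeval u Q : ℝ) ≠ 0) :
    ∃ (s : ℕ) (pp : Fin s → Polynomial ℝ) (cc : Fin s → ℝ) (s' : ℕ) (AA BB : Fin s' → Polynomial ℝ) (dd : Fin s' → ℝ)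
      (G₀ g₀ : ℝ → ℝ),
      (∀ j n, IsAlgebraic ℚ ((pp j).coeff n)) ∧ (∀ j, IsAlgebraic ℚ (cc j)) ∧
      (∀ j, ∀ u ∈ Set.Icc (0:ℝ) 1, 0 < (pp j).eval u) ∧
      (∀ k n, IsAlgebraic ℚ ((AA k).coeff n)) ∧ (∀ k n, IsAlgebraic ℚ ((BB k).coeff n)) ∧
      (∀ k, IsAlgebraic ℚ (dd k)) ∧ (∀ k, ∀ u ∈ Set.Icc (0:ℝ) 1, (AA k).eval u ^ 2 + (BB k).eval u ^ 2 ≠ 0) ∧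
      IsSemialgebraicFunOn ℚ (Set.pi Set.univ (fun _ : Fin 1 => Set.Icc (0:ℝ) 1)) (fun z => G₀ (z 0)) ∧
      IsSemialgebraicFunOn ℚ (Set.pi Set.univ (fun _ : Fin 1 => Set.Icc (0:ℝ) 1)) (fun z => g₀ (z 0)) ∧
      (∀ u ∈ Set.Icc (0:ℝ) 1, HasDerivAt G₀ (g₀ u) u) ∧ ContinuousOn g₀ (Set.Icc (0:ℝ) 1) ∧
      ∀ w ∈ Set.Icc (0:ℝ) 1, (Polynomial.aeval w P : ℝ) / Polynomial.aeval w Q =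
        g₀ w + ∑ j, cc j * ((Polynomial.derivative (pp j)).eval w / (pp j).eval w) +
          ∑ k, dd k * (((AA k).eval w * (Polynomial.derivative (BB k)).eval w -
            (Polynomial.derivative (AA k)).eval w * (BB k).eval w) / ((AA k).eval w ^ 2 + (BB k).eval w ^ 2)) := by
  classical
  have hS := isSemialgebraic_cubePi_one
  have hφc : ∀ x : algebraicClosure ℚ ℝ, algebraMap (algebraicClosure ℚ ℝ) ℝ x = (x : ℝ) := fun x => rfl
  have hQ0 : Q ≠ 0 := fun h => hQ 0 ⟨le_rfl, zero_le_one⟩ (by rw [h, map_zero])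
  obtain ⟨E, m, c, ρ, k, m', a, b, u, v, n, hρ, hvpos, hpf⟩ := stub_rawPartialFractions P Q hQ0
  -- the real poles are off `[0,1]`
  have hρout : ∀ i, ∀ w ∈ Set.Icc (0:ℝ) 1, w - (ρ i : ℝ) ≠ 0 := by
    intro i w hw hzero
    have hw' : w = (ρ i : ℝ) := sub_eq_zero.mp hzero
    apply hQ w hw
    rw [hw', aevalK_coe, Polynomial.coe_aeval_eq_eval, (hρ i).eq_zero]; simp
  have hρsign : ∀ i, (ρ i : ℝ) < 0 ∨ 1 < (ρ i : ℝ) := by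
    intro i
    by_contra hcon
    push Not at hcon
    exact hρout i (ρ i) ⟨hcon.1, hcon.2⟩ (sub_self _)
  -- the quadratic reduction certificates
  have hW4 := fun l => stub_quadPoleReduction (u l) (v l) (a l) (b l) (n l) (hvpos l).ne' (isAlgebraic_coeK _)
    (isAlgebraic_coeK _) (isAlgebraic_coeK _) (isAlgebraic_coeK _)
  choose S e₁ e₂ hS' he₁ he₂ hSd using hW4
  have hqpos : ∀ l (w : ℝ), 0 < (w - u l) ^ 2 + (v l : ℝ) ^ 2 := fun l w =>
    add_pos_of_nonneg_of_pos (sq_nonneg _) (pow_pos (hvpos l) 2)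
  -- the dlog family: `m` signed linear polynomials, `m'` quadratics (over `K`, mapped to `ℝ[X]`)
  set pK : Fin m → Polynomial (algebraicClosure ℚ ℝ) := fun i =>
    if (ρ i : ℝ) < 0 then Polynomial.X - Polynomial.C (ρ i) else Polynomial.C (ρ i) - Polynomial.X with hpK
  set qK : Fin m' → Polynomial (algebraicClosure ℚ ℝ) := fun l =>
    (Polynomial.X - Polynomial.C (u l)) ^ 2 + Polynomial.C ((v l) ^ 2) with hqK
  have hpK_eval : ∀ i (w : ℝ), Polynomial.aeval w (pK i) =
      if (ρ i : ℝ) < 0 then w - ρ i else (ρ i : ℝ) - w := by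
    intro i w
    simp only [hpK]
    split_ifs <;> simp only [map_sub, Polynomial.aeval_X, Polynomial.aeval_C, hφc]
  have hpK_der : ∀ i (w : ℝ), Polynomial.aeval w (Polynomial.derivative (pK i)) =
      if (ρ i : ℝ) < 0 then (1:ℝ) else -1 := by
    intro i w
    simp only [hpK]
    split_ifs <;> simp only [Polynomial.derivative_sub, Polynomial.derivative_X, Polynomial.derivative_C,
      sub_zero, zero_sub, map_neg, Polynomial.aeval_one]
  have hqK_eval : ∀ l (w : ℝ), Polynomial.aeval w (qK l) = (w - u l) ^ 2 + (v l : ℝ) ^ 2 := by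
    intro l w
    simp only [hqK, map_add, map_pow, map_sub, Polynomial.aeval_X, Polynomial.aeval_C, hφc]
  have hqK_der : ∀ l (w : ℝ), Polynomial.aeval w (Polynomial.derivative (qK l)) = 2 * (w - u l) := by
    intro l w
    have hd : Polynomial.derivative (qK l) = Polynomial.C (2 : algebraicClosure ℚ ℝ) * (Polynomial.X - Polynomial.C (u l)) := by
      simp only [hqK, Polynomial.derivative_add, Polynomial.derivative_pow, Polynomial.derivative_sub,
        Polynomial.derivative_X, Polynomial.derivative_C, sub_zero, mul_one, add_zero, Nat.cast_ofNat,
        Nat.add_one_sub_one, pow_one]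
    rw [hd, map_mul, Polynomial.aeval_C, map_ofNat, map_sub, Polynomial.aeval_X, Polynomial.aeval_C, hφc]
  set pp : Fin (m + m') → Polynomial ℝ :=
    Fin.append (fun i => (pK i).map (algebraMap (algebraicClosure ℚ ℝ) ℝ)) (fun l => (qK l).map (algebraMap (algebraicClosure ℚ ℝ) ℝ)) with hpp
  set cc : Fin (m + m') → ℝ := Fin.append (fun i => if k i = 0 then (c i : ℝ) else 0) e₁ with hcc
  have hpp_alg : ∀ j nn, IsAlgebraic ℚ ((pp j).coeff nn) := by
    refine Fin.addCases (fun i nn => ?_) (fun l nn => ?_)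
    · simp only [hpp, Fin.append_left]; exact isAlgebraic_coeff_mapK _ _
    · simp only [hpp, Fin.append_right]; exact isAlgebraic_coeff_mapK _ _
  have hcc_alg : ∀ j, IsAlgebraic ℚ (cc j) := by
    refine Fin.addCases (fun i => ?_) (fun l => ?_)
    · simp only [hcc, Fin.append_left]
      split_ifs
      · exact isAlgebraic_coeK _
      · exact isAlgebraic_zero
    · simp only [hcc, Fin.append_right]; exact he₁ l
  have hpp_pos : ∀ j, ∀ w ∈ Set.Icc (0:ℝ) 1, 0 < (pp j).eval w := by
    refine Fin.addCases (fun i w hw => ?_) (fun l w _ => ?_)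
    · simp only [hpp, Fin.append_left, eval_mapK, hpK_eval]
      rcases hρsign i with h | h
      · rw [if_pos h]; linarith [hw.1]
      · rw [if_neg (by linarith)]; linarith [hw.2]
    · simp only [hpp, Fin.append_right, eval_mapK, hqK_eval]; exact hqpos l w
  -- the angular family: the linear loops `t − u_l + i v_l`
  set AA : Fin m' → Polynomial ℝ := fun l => (Polynomial.X - Polynomial.C (u l)).map (algebraMap (algebraicClosure ℚ ℝ) ℝ) with hAA
  set BB : Fin m' → Polynomial ℝ := fun l => (Polynomial.C (v l) : Polynomial (algebraicClosure ℚ ℝ)).map (algebraMap (algebraicClosure ℚ ℝ) ℝ) with hBB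
  set dd : Fin m' → ℝ := fun l => -e₂ l with hdd
  have hAA_eval : ∀ l (w : ℝ), (AA l).eval w = w - u l := fun l w => by
    rw [hAA, eval_mapK, map_sub, Polynomial.aeval_X, Polynomial.aeval_C, hφc]
  have hBB_eval : ∀ l (w : ℝ), (BB l).eval w = v l := fun l w => by
    rw [hBB, eval_mapK, Polynomial.aeval_C, hφc]
  have hAA_der : ∀ l (w : ℝ), (Polynomial.derivative (AA l)).eval w = 1 := fun l w => by
    rw [hAA, eval_derivative_mapK, Polynomial.derivative_sub, Polynomial.derivative_X,
      Polynomial.derivative_C, sub_zero, Polynomial.aeval_one]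
  have hBB_der : ∀ l (w : ℝ), (Polynomial.derivative (BB l)).eval w = 0 := fun l w => by
    rw [hBB, eval_derivative_mapK, Polynomial.derivative_C, map_zero]
  have hang : ∀ l (w : ℝ), ((AA l).eval w * (Polynomial.derivative (BB l)).eval w -
      (Polynomial.derivative (AA l)).eval w * (BB l).eval w) / ((AA l).eval w ^ 2 + (BB l).eval w ^ 2) =
      -(v l : ℝ) / ((w - u l) ^ 2 + (v l : ℝ) ^ 2) := fun l w => by
    rw [hAA_eval, hBB_eval, hAA_der, hBB_der]; ring
  have hAB : ∀ l, ∀ w ∈ Set.Icc (0:ℝ) 1, (AA l).eval w ^ 2 + (BB l).eval w ^ 2 ≠ 0 := fun l w _ => by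
    rw [hAA_eval, hBB_eval]; exact (hqpos l w).ne'
  -- the exact part: primitive `G₀` and its derivative `D`
  obtain ⟨GE, hGE⟩ := exists_polynomial_hasDerivAtK E
  set primR : Fin m → ℝ → ℝ := fun i w =>
    if k i = 0 then 0 else (-(c i : ℝ) / (k i)) / (w - ρ i) ^ (k i) with hprimR
  set derR : Fin m → ℝ → ℝ := fun i w =>
    if k i = 0 then 0 else (c i : ℝ) / (w - ρ i) ^ (k i + 1) with hderR
  have hprimR_der : ∀ i w, w - (ρ i : ℝ) ≠ 0 → HasDerivAt (primR i) (derR i w) w := by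
    intro i w hw
    by_cases hk : k i = 0
    · simp only [hprimR, hderR, hk, if_true]
      exact hasDerivAt_const w 0
    · obtain ⟨j, hj⟩ : ∃ j, k i = j + 1 := Nat.exists_eq_succ_of_ne_zero hk
      simp only [hprimR, hderR, hj, Nat.succ_ne_zero, if_false]
      convert hasDerivAt_const_div_pow (-(c i : ℝ) / ((j + 1 : ℕ) : ℝ)) (ρ i) j hw using 1
      push_cast
      field_simp
  set quadD : Fin m' → ℝ → ℝ := fun l w =>
    ((a l : ℝ) * w + b l) / ((w - u l) ^ 2 + (v l : ℝ) ^ 2) ^ (n l + 1)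
      - e₁ l * (2 * (w - u l)) / ((w - u l) ^ 2 + (v l : ℝ) ^ 2) - e₂ l * v l / ((w - u l) ^ 2 + (v l : ℝ) ^ 2)
    with hquadD
  set G₀ : ℝ → ℝ := fun w => Polynomial.aeval w GE + ∑ i, primR i w +
    ∑ l, (S l).eval w / ((w - u l) ^ 2 + (v l : ℝ) ^ 2) ^ (n l) with hG₀
  set D : ℝ → ℝ := fun w => Polynomial.aeval w E + ∑ i, derR i w + ∑ l, quadD l w with hD
  have hGD : ∀ w ∈ Set.Icc (0:ℝ) 1, HasDerivAt G₀ (D w) w := by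
    intro w hw
    refine ((hGE w).add (HasDerivAt.fun_sum fun i _ => hprimR_der i w (hρout i w hw))).add
      (HasDerivAt.fun_sum fun l _ => ?_)
    exact hSd l w
  -- the mixed exact part `g₀ := P/Q − dlog part − angular part`, and `g₀ = D` on `[0,1]`
  set g₀ : ℝ → ℝ := fun w => (Polynomial.aeval w P : ℝ) / Polynomial.aeval w Q -
    ∑ j, cc j * ((Polynomial.derivative (pp j)).eval w / (pp j).eval w) -
    ∑ l, dd l * (((AA l).eval w * (Polynomial.derivative (BB l)).eval w -
      (Polynomial.derivative (AA l)).eval w * (BB l).eval w) / ((AA l).eval w ^ 2 + (BB l).eval w ^ 2)) with hg₀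
  have hdlog_real : ∀ i, ∀ w ∈ Set.Icc (0:ℝ) 1,
      (Polynomial.derivative (pp (Fin.castAdd m' i))).eval w / (pp (Fin.castAdd m' i)).eval w = 1 / (w - ρ i) := by
    intro i w hw
    simp only [hpp, Fin.append_left, eval_mapK, eval_derivative_mapK, hpK_eval, hpK_der]
    have hne := hρout i w hw
    split_ifs with h
    · rfl
    · have : (ρ i : ℝ) - w ≠ 0 := fun h' => hne (by linarith)
      field_simp
      ring
  have hdlog_quad : ∀ l (w : ℝ),
      (Polynomial.derivative (pp (Fin.natAdd m l))).eval w / (pp (Fin.natAdd m l)).eval w =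
        2 * (w - u l) / ((w - u l) ^ 2 + (v l : ℝ) ^ 2) := by
    intro l w
    simp only [hpp, Fin.append_right, eval_mapK, eval_derivative_mapK, hqK_eval, hqK_der]
  have hg₀D : ∀ w ∈ Set.Icc (0:ℝ) 1, g₀ w = D w := by
    intro w hw
    have hQw := hQ w hw
    simp only [hg₀, hD]
    rw [hpf w hQw, Fin.sum_univ_add]
    simp only [hdlog_real _ w hw, hdlog_quad, hang, hcc, hdd, Fin.append_left, Fin.append_right]
    -- termwise identities
    have hreal : ∀ i, (c i : ℝ) / (w - ρ i) ^ (k i + 1) =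
        derR i w + (if k i = 0 then (c i : ℝ) else 0) * (1 / (w - ρ i)) := by
      intro i
      simp only [hderR]
      split_ifs with hk
      · rw [hk]; ring
      · ring
    have hquad : ∀ l, ((a l : ℝ) * w + b l) / ((w - u l) ^ 2 + (v l : ℝ) ^ 2) ^ (n l + 1) =
        quadD l w + e₁ l * (2 * (w - u l) / ((w - u l) ^ 2 + (v l : ℝ) ^ 2)) +
          -e₂ l * (-(v l : ℝ) / ((w - u l) ^ 2 + (v l : ℝ) ^ 2)) := by
      intro l
      simp only [hquadD]
      ring
    simp only [hreal, hquad, Finset.sum_add_distrib]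
    ring
  have hder : ∀ w ∈ Set.Icc (0:ℝ) 1, HasDerivAt G₀ (g₀ w) w := fun w hw => by
    rw [hg₀D w hw]; exact hGD w hw
  -- semialgebraicity of `G₀`, `g₀`; continuity of `g₀`
  have hcoord := isSemialgebraicFunOn_apply hS (0 : Fin 1)
  have hprimR_sa : ∀ i, IsSemialgebraicFunOn ℚ (Set.pi Set.univ (fun _ : Fin 1 => Set.Icc (0:ℝ) 1))
      (fun z => primR i (z 0)) := by
    intro i
    by_cases hk : k i = 0
    · simp only [hprimR, hk, if_true]; exact isSemialgebraicFunOn_const_of_isAlgebraic hS isAlgebraic_zero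
    · simp only [hprimR, hk, if_false]
      refine (isSemialgebraicFunOn_const_of_isAlgebraic hS ?_).div
        ((hcoord.fun_sub (isSemialgebraicFunOn_const_of_isAlgebraic hS (isAlgebraic_coeK _))).fun_pow _)
        fun z hz => pow_ne_zero _ (hρout i (z 0) (hz 0 (Set.mem_univ _)))
      exact ((isAlgebraic_coeK (c i)).neg).mul (isAlgebraic_nat (k i)).inv
  have hquadP_sa : ∀ l, IsSemialgebraicFunOn ℚ (Set.pi Set.univ (fun _ : Fin 1 => Set.Icc (0:ℝ) 1))
      (fun z => (S l).eval (z 0) / (((z 0) - u l) ^ 2 + (v l : ℝ) ^ 2) ^ (n l)) := fun l =>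
    (isSemialgebraicFunOn_eval_apply hS (hS' l) 0).div
      (((hcoord.fun_sub (isSemialgebraicFunOn_const_of_isAlgebraic hS (isAlgebraic_coeK _))).fun_pow 2 |>.fun_add
        ((isSemialgebraicFunOn_const_of_isAlgebraic hS (isAlgebraic_coeK _)).fun_pow 2)).fun_pow _)
      fun z _ => pow_ne_zero _ (hqpos l (z 0)).ne'
  have hG₀sa : IsSemialgebraicFunOn ℚ (Set.pi Set.univ (fun _ : Fin 1 => Set.Icc (0:ℝ) 1)) (fun z => G₀ (z 0)) :=
    ((isSemialgebraicFunOn_aevalK hS GE).fun_add (IsSemialgebraicFunOn.fun_finsetSum _ hS fun i _ => hprimR_sa i)).fun_add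
      (IsSemialgebraicFunOn.fun_finsetSum _ hS fun l _ => hquadP_sa l)
  have hdlog_sa : ∀ j, IsSemialgebraicFunOn ℚ (Set.pi Set.univ (fun _ : Fin 1 => Set.Icc (0:ℝ) 1))
      (fun z => cc j * ((Polynomial.derivative (pp j)).eval (z 0) / (pp j).eval (z 0))) := fun j =>
    (isSemialgebraicFunOn_const_of_isAlgebraic hS (hcc_alg j)).fun_mul
      (isSemialgebraicFunOn_logDeriv (hpp_alg j) (hpp_pos j))
  have hAA_alg : ∀ l nn, IsAlgebraic ℚ ((AA l).coeff nn) := fun l nn => isAlgebraic_coeff_mapK _ _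
  have hBB_alg : ∀ l nn, IsAlgebraic ℚ ((BB l).coeff nn) := fun l nn => isAlgebraic_coeff_mapK _ _
  have hdd_alg : ∀ l, IsAlgebraic ℚ (dd l) := fun l => (he₂ l).neg
  have hang_sa : ∀ l, IsSemialgebraicFunOn ℚ (Set.pi Set.univ (fun _ : Fin 1 => Set.Icc (0:ℝ) 1))
      (fun z => dd l * (((AA l).eval (z 0) * (Polynomial.derivative (BB l)).eval (z 0) -
        (Polynomial.derivative (AA l)).eval (z 0) * (BB l).eval (z 0)) / ((AA l).eval (z 0) ^ 2 + (BB l).eval (z 0) ^ 2))) :=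
    fun l => (isSemialgebraicFunOn_const_of_isAlgebraic hS (hdd_alg l)).fun_mul
      (isSemialgebraicFunOn_angular (hAA_alg l) (hBB_alg l) (hAB l))
  have hPQ_sa : IsSemialgebraicFunOn ℚ (Set.pi Set.univ (fun _ : Fin 1 => Set.Icc (0:ℝ) 1))
      (fun z => (Polynomial.aeval (z 0) P : ℝ) / Polynomial.aeval (z 0) Q) :=
    isSemialgebraicFunOn_aevalK_div hS P Q fun z hz => hQ (z 0) (hz 0 (Set.mem_univ _))
  have hg₀sa : IsSemialgebraicFunOn ℚ (Set.pi Set.univ (fun _ : Fin 1 => Set.Icc (0:ℝ) 1)) (fun z => g₀ (z 0)) :=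
    (hPQ_sa.fun_sub (IsSemialgebraicFunOn.fun_finsetSum _ hS fun j _ => hdlog_sa j)).fun_sub
      (IsSemialgebraicFunOn.fun_finsetSum _ hS fun l _ => hang_sa l)
  have hg₀c : ContinuousOn g₀ (Set.Icc (0:ℝ) 1) := by
    refine ContinuousOn.sub (ContinuousOn.sub ?_ (continuousOn_finsetSum _ fun j _ => continuousOn_const.mul ?_))
      (continuousOn_finsetSum _ fun l _ => continuousOn_const.mul (continuousOn_angular _ _ (hAB l)))
    · exact (Polynomial.continuous_aeval P).continuousOn.div (Polynomial.continuous_aeval Q).continuousOn hQ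
    · have := continuousOn_logDeriv_poly (pp j) (hpp_pos j)
      rwa [Set.uIcc_of_le zero_le_one] at this
  -- part II applies
  refine ⟨m + m', pp, cc, m', AA, BB, dd, G₀, g₀, hpp_alg, hcc_alg, hpp_pos, hAA_alg, hBB_alg, hdd_alg, hAB, hG₀sa, hg₀sa,
    hder, hg₀c, fun w _ => ?_⟩
  simp only [hg₀]
  ring

/-- **S2 on the whole rational layer of dimension one over the real algebraic numbers (rung 8, part III; lead
c5).** A closed-interval representation with integrand `P/Q`, `P, Q ∈ K[X]` (`K = algebraicClosure ℚ ℝ`), `Q`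
zero-free on `[0,1]`, and value `0` is fibrewise-Stokes decomposable: pointwise real partial fractions over `K`
(`stub_rawPartialFractions`) present `P/Q` on `[0,1]` as a mixed form — the polynomial part and the higher-order real
poles are exact, a simple real pole `c/(t − ρ)` (`ρ ∉ [0,1]`) is the dlog of the positive linear polynomial
`±(t − ρ)`, and `(a t + b)/((t − u)² + v²)^{n+1}` is exact + dlog of the positive quadratic + a multiple of the
angular derivative of the linear loop `t − u + iv` (`stub_quadPoleReduction`) — and part II applies. This is the
S2-economy twin of the kernel form `stub_kernelAlgKInterval`. [cite: KontsevichZagier2001, §1.2] -/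
theorem fibStokesDecomposable_ratAlgK (P Q : Polynomial (algebraicClosure ℚ ℝ))
    (hQ : ∀ u ∈ Set.Icc (0:ℝ) 1, (Polynomial.aeval u Q : ℝ) ≠ 0)
    (t : IntegralRep 1) (ht : t.domain = Set.pi Set.univ (fun _ : Fin 1 => Set.Icc (0:ℝ) 1))
    (hti : ∀ z ∈ Set.pi Set.univ (fun _ : Fin 1 => Set.Icc (0:ℝ) 1), t.integrand z =
      (Polynomial.aeval (z 0) P : ℝ) / Polynomial.aeval (z 0) Q)
    (hv : t.value = 0) : FibStokesDecomposable 1 t.integrand := by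
  obtain ⟨s, pp, cc, s', AA, BB, dd, G₀, g₀, hpp, hcc, hpos, hAA, hBB, hdd, hAB, hG₀, hg₀, hder, hg₀c, hmix⟩ :=
    exists_mixedForm_ratAlgK P Q hQ
  exact fibStokesDecomposable_dimOneMixed s pp cc s' AA BB dd G₀ g₀ hpp hcc hpos hAA hBB hdd hAB hG₀ hg₀ hder hg₀c t ht
    (fun z hz => by rw [hti z hz]; exact hmix (z 0) (hz 0 (Set.mem_univ _))) hv


/-- **Kernel form on the rational layer, through S2's economy.** A closed-interval representation with integrand
`P/Q` (`P, Q ∈ K[X]`, `Q` zero-free on `[0,1]`) and value `0` is a Kontsevich–Zagier relation — by decomposability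
(`fibStokesDecomposable_ratAlgK`) and the landed bridge `of_mem_relations_of_fibStokesDecomposable` (lift, excise,
calibrate each fibrewise Stokes element by rule (3)). [cite: KontsevichZagier2001, §1.2 Conjecture 1] -/
theorem of_mem_relations_ratAlgK (P Q : Polynomial (algebraicClosure ℚ ℝ))
    (hQ : ∀ u ∈ Set.Icc (0:ℝ) 1, (Polynomial.aeval u Q : ℝ) ≠ 0)
    (t : IntegralRep 1) (ht : t.domain = Set.pi Set.univ (fun _ : Fin 1 => Set.Icc (0:ℝ) 1))
    (hti : ∀ z ∈ Set.pi Set.univ (fun _ : Fin 1 => Set.Icc (0:ℝ) 1), t.integrand z =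
      (Polynomial.aeval (z 0) P : ℝ) / Polynomial.aeval (z 0) Q)
    (hv : t.value = 0) : of t ∈ relations :=
  of_mem_relations_of_fibStokesDecomposable 1 t ht (fibStokesDecomposable_ratAlgK P Q hQ t ht hti hv)

end Summit.KontsevichZagierPeriods.KontsevichZagierPeriods.Cruxes.StokesGeneration.FibrewiseStokes

end
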